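import Mathlib
import Literature.RingTheory.KrullDimension.AffineDimension
import Literature.RingTheory.Elimination.TopComponents
import HarnessLib

/-!
# Generic square combinations of a polynomial system cut out only points off the system's zero
# set (Kronecker's method with indeterminate coefficients), and isolating a point of a zero set

Topic: `Literature/RingTheory/Elimination`. Kronecker's method of "sufficiently general linear
combinations" replaces an arbitrary system `S_1, …, S_t ∈ K₁[X_1, …, X_n]` by a SQUARE system
`F_i = Σ_k a_{ik} S_k` (`i = 1, …, n`) whose zero set consists of `Z(S)` and finitely many further
points (Bürgisser, *Cook's versus Valiant's hypothesis*, TCS 235 (2000), Lemma 4.3 and its proof,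
p. 80–81: "there exist `a_{ij}` … such that `dim V ∩ Z(G_1, …, G_{j+1}) = m - j - 1`"; the same
device in Giusti–Heintz' determination of isolated points). The tree's `TopComponents.lean` /
`BurgisserZeroDimSlice.lean` carry this out with small NATURAL coefficients when `Z(S)` is already
finite inside a slice, counting the components to be avoided. Here we prove the coefficient-free
form with INDETERMINATE coefficients, which needs no count and tolerates components of `Z(S)` of
any dimension: if the `a_{ik} = α_{ik}` form a transcendence basis of the (algebraically closed)
field `K₂` over the field of coefficients `K₁`, then

* `ringKrullDim_quotient_eq_zero_of_generic_combinations`, `isMaximal_of_generic_combinations` —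
  **every prime `P ⊇ (F_1, …, F_n)` of `K₂[X]` not containing all the `S_k` is maximal**
  (so every component of `Z(F)` outside `Z(S)` is a point). Proof by transcendence degree
  (Stacks 030H): for `D = K₂[X]/P`, `trdeg_{K₁} D = trdeg_{K₁} K₂ + dim D = nt + dim D`, while
  `D` is algebraic over `K₁(x̄, α_{ik} : k ≠ k₀)` (each relation `F_i = 0` with `S̄_{k₀} ≠ 0` makes
  `α_{ik₀}` algebraic over the rest), a field with `≤ nt` generators; hence `dim D = 0`.
* `exists_isolating_polynomial` — if the ideal `𝔪_z` of a point `z ∈ Z(J)` is the only prime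
  between `J` and `𝔪_z`, then some polynomial `g` with `g(z) ≠ 0` has `Z(J) ∩ {g ≠ 0} ⊆ {z}`
  (take a product of elements of the other minimal primes of `J` avoiding `𝔪_z`) — the form of
  "isolated zero" consumed by the local limit lemma `eval_sLead_pertCharpoly_eq_zero_of_isolated`.

## References

* P. Bürgisser, *Cook's versus Valiant's hypothesis*, TCS 235 (2000) 71–88, Lemma 4.3 (p. 80–81).
  [Burgisser2000TCS]
* The Stacks project, Tag 030H (additivity of transcendence degree). [folklore]
-/

namespace Literature.RingTheory.Elimination

open MvPolynomial

/-! ### Generic combinations: primes off `Z(S)` are maximal -/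

section Generic

variable {K₁ K₂ : Type*} [Field K₁] [Field K₂] [Algebra K₁ K₂] {n t : ℕ}

/-- In `K₂[X]/P`, the class of `S^{K₂}` is `S(x̄)` as a `K₁`-algebra evaluation at the classes
`x̄_j` of the variables. [folklore] -/
private theorem mk_map_eq_aeval (P : Ideal (MvPolynomial (Fin n) K₂)) (S : MvPolynomial (Fin n) K₁) :
    Ideal.Quotient.mk P (map (algebraMap K₁ K₂) S) =
      aeval (fun j => Ideal.Quotient.mk P (X j : MvPolynomial (Fin n) K₂)) S := by
  have h : ((Ideal.Quotient.mkₐ K₁ P).comp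
      (MvPolynomial.mapAlgHom (σ := Fin n) (Algebra.ofId K₁ K₂)) : MvPolynomial (Fin n) K₁ →ₐ[K₁] _) =
      aeval (fun j => Ideal.Quotient.mk P (X j : MvPolynomial (Fin n) K₂)) := by
    refine MvPolynomial.algHom_ext fun j => ?_
    simp
  have := congrArg (fun φ => φ S) h
  simpa using this

set_option synthInstance.maxHeartbeats 200000 in
/-- **Generic square combinations cut down to points off `Z(S)`** (Kronecker's method with
indeterminate coefficients; Bürgisser 2000, Lemma 4.3). Let `α_{ik} ∈ K₂` (`i < n`, `k < t`) form a
transcendence basis of `K₂/K₁`, `S_1, …, S_t ∈ K₁[X_1, …, X_n]`, and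
`F_i = Σ_k α_{ik} S_k ∈ K₂[X]`. Then every prime ideal `P ⊇ (F_1, …, F_n)` of `K₂[X]` with some
`S_{k₀} ∉ P` has `dim K₂[X]/P = 0`. [cite: Burgisser2000TCS, Lemma 4.3 p. 80] -/
theorem ringKrullDim_quotient_eq_zero_of_generic_combinations
    (α : Fin n × Fin t → K₂) (hα : IsTranscendenceBasis K₁ α)
    (S : Fin t → MvPolynomial (Fin n) K₁) (P : Ideal (MvPolynomial (Fin n) K₂)) [hP : P.IsPrime]
    (hF : ∀ i, (∑ k, C (α (i, k)) * map (algebraMap K₁ K₂) (S k)) ∈ P)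
    {k₀ : Fin t} (hS : map (algebraMap K₁ K₂) (S k₀) ∉ P) :
    ringKrullDim (MvPolynomial (Fin n) K₂ ⧸ P) = 0 := by
  classical
  -- the affine domain `D = K₂[X]/P`
  set D := MvPolynomial (Fin n) K₂ ⧸ P with hD
  haveI : IsDomain D := Ideal.Quotient.isDomain P
  haveI : Algebra.FiniteType K₂ D :=
    Algebra.FiniteType.of_surjective (Ideal.Quotient.mkₐ K₂ P) (Ideal.Quotient.mkₐ_surjective K₂ P)
  obtain ⟨s, hs_dim, hs_tr⟩ :=
    Literature.RingTheory.KrullDimension.exists_ringKrullDim_eq_and_trdeg_eq K₂ D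
  rw [hs_dim]
  -- the elements of `D` in play
  set xb : Fin n → D := fun j => Ideal.Quotient.mk P (X j) with hxb
  set αD : Fin n × Fin t → D := fun p => algebraMap K₂ D (α p) with hαD
  set sb : Fin t → D := fun k => Ideal.Quotient.mk P (map (algebraMap K₁ K₂) (S k)) with hsb
  have hsb_aeval : ∀ k, sb k = aeval xb (S k) := fun k => mk_map_eq_aeval P (S k)
  have hsb0 : sb k₀ ≠ 0 := by
    rw [hsb]; dsimp only
    rwa [Ne, Ideal.Quotient.eq_zero_iff_mem]
  have hmkC : ∀ a : K₂, Ideal.Quotient.mk P (C a) = algebraMap K₂ D a := fun a => rfl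
  have hrel : ∀ i, ∑ k, αD (i, k) * sb k = 0 := by
    intro i
    have h := (Ideal.Quotient.eq_zero_iff_mem).2 (hF i)
    rw [map_sum] at h
    simp only [map_mul, hmkC] at h
    exact h
  -- the small generating set: `x̄` and the `α_{ik}`, `k ≠ k₀`
  let ι := Fin n ⊕ (Fin n × {k : Fin t // k ≠ k₀})
  let v : ι → D := fun e => match e with
    | Sum.inl j => xb j
    | Sum.inr (i, k) => αD (i, k.1)
  set sT : Set D := Set.range v with hsT
  set sBig : Set D := Set.range xb ∪ Set.range αD with hsBig
  -- every element of `D` is algebraic over `K₁[x̄, α]`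
  haveI : IsDomain (Algebra.adjoin K₁ sBig) := Subalgebra.isDomain _
  have halgK₂ : ∀ c : K₂, IsAlgebraic (Algebra.adjoin K₁ sBig) (algebraMap K₂ D c) := by
    intro c
    haveI := hα.isAlgebraic
    have hc : IsAlgebraic (Algebra.adjoin K₁ (Set.range α)) c := Algebra.IsAlgebraic.isAlgebraic c
    -- transport along `K₂ → D`
    let φ : K₂ →ₐ[K₁] D := IsScalarTower.toAlgHom K₁ K₂ D
    have hmap : (Algebra.adjoin K₁ (Set.range α)).map φ = Algebra.adjoin K₁ (Set.range αD) := by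
      rw [AlgHom.map_adjoin]
      congr 1
      ext d
      simp only [Set.mem_image, Set.mem_range, hαD]
      constructor
      · rintro ⟨_, ⟨p, rfl⟩, rfl⟩; exact ⟨p, rfl⟩
      · rintro ⟨p, rfl⟩; exact ⟨α p, ⟨p, rfl⟩, rfl⟩
    let f : Algebra.adjoin K₁ (Set.range α) →ₐ[K₁] Algebra.adjoin K₁ (Set.range αD) :=
      (φ.comp (Algebra.adjoin K₁ (Set.range α)).val).codRestrict (Algebra.adjoin K₁ (Set.range αD))
        (fun x => hmap.le ⟨x.1, x.2, rfl⟩)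
    have hf : Function.Injective f := by
      intro a b hab
      have h' := congrArg (fun y : Algebra.adjoin K₁ (Set.range αD) => (y : D)) hab
      have h'' : algebraMap K₂ D (a : K₂) = algebraMap K₂ D (b : K₂) := by
        simpa [f, φ, IsScalarTower.coe_toAlgHom'] using h'
      exact Subtype.ext ((algebraMap K₂ D).injective h'')
    have hcomp : (algebraMap (Algebra.adjoin K₁ (Set.range αD)) D).comp f.toRingHom =
        (algebraMap K₂ D).comp (algebraMap (Algebra.adjoin K₁ (Set.range α)) K₂) := by
      apply RingHom.ext
      intro a
      rfl
    have h1 : IsAlgebraic (Algebra.adjoin K₁ (Set.range αD)) (algebraMap K₂ D c) :=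
      hc.ringHom_of_comp_eq f.toRingHom (algebraMap K₂ D) hf hcomp
    exact h1.tower_top_of_subalgebra_le (Algebra.adjoin_mono Set.subset_union_right)
  have hbig : ∀ a : D, IsAlgebraic (Algebra.adjoin K₁ sBig) a := by
    intro a
    obtain ⟨p, rfl⟩ := Ideal.Quotient.mk_surjective a
    rw [← Subalgebra.mem_algebraicClosure]
    induction p using MvPolynomial.induction_on with
    | C c =>
      rw [Subalgebra.mem_algebraicClosure, hmkC]
      exact halgK₂ c
    | add p q hp hq => rw [map_add]; exact add_mem hp hq
    | mul_X p j hp =>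
      rw [map_mul]
      refine mul_mem hp ?_
      rw [Subalgebra.mem_algebraicClosure]
      have hx : (Ideal.Quotient.mk P (X j) : D) ∈ Algebra.adjoin K₁ sBig :=
        Algebra.subset_adjoin (Set.mem_union_left _ ⟨j, rfl⟩)
      exact isAlgebraic_algebraMap (⟨_, hx⟩ : Algebra.adjoin K₁ sBig)
  -- … hence over the small set, the `α_{ik₀}` being algebraic over it by the relations `F_i = 0`
  have hsT_sub : sT ⊆ sBig := by
    rintro _ ⟨e, rfl⟩
    rcases e with j | ⟨i, k⟩
    · exact Set.mem_union_left _ ⟨j, rfl⟩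
    · exact Set.mem_union_right _ ⟨(i, k.1), rfl⟩
  have hsb_mem : ∀ k, sb k ∈ Algebra.adjoin K₁ sT := by
    intro k
    rw [hsb_aeval]
    have : Algebra.adjoin K₁ (Set.range xb) ≤ Algebra.adjoin K₁ sT :=
      Algebra.adjoin_mono (by rintro _ ⟨j, rfl⟩; exact ⟨Sum.inl j, rfl⟩)
    apply this
    rw [Algebra.adjoin_range_eq_range_aeval]
    exact ⟨S k, rfl⟩
  have hαD_mem : ∀ i (k : Fin t), k ≠ k₀ → αD (i, k) ∈ Algebra.adjoin K₁ sT :=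
    fun i k hk => Algebra.subset_adjoin ⟨Sum.inr (i, ⟨k, hk⟩), rfl⟩
  haveI : IsDomain (Algebra.adjoin K₁ sT) := Subalgebra.isDomain _
  have hdiff : ∀ x ∈ sBig \ sT, IsAlgebraic (Algebra.adjoin K₁ sT) x := by
    rintro x ⟨hx, hxT⟩
    rcases hx with ⟨j, rfl⟩ | ⟨⟨i, k⟩, rfl⟩
    · exact absurd ⟨Sum.inl j, rfl⟩ hxT
    · by_cases hk : k = k₀
      · subst hk
        -- the linear relation `S̄_{k₀} · α_{ik₀} + Σ_{k ≠ k₀} α_{ik} S̄_k = 0`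
        set a : Algebra.adjoin K₁ sT := ⟨sb k, hsb_mem k⟩ with ha
        have hrest : (∑ k' ∈ Finset.univ.erase k, αD (i, k') * sb k') ∈ Algebra.adjoin K₁ sT := by
          refine Subalgebra.sum_mem _ fun k' hk' => ?_
          exact Subalgebra.mul_mem _ (hαD_mem i k' (Finset.mem_erase.1 hk').1) (hsb_mem k')
        set b : Algebra.adjoin K₁ sT := ⟨_, hrest⟩ with hb
        refine ⟨Polynomial.C a * Polynomial.X + Polynomial.C b, ?_, ?_⟩
        · intro h0
          have h1 := congrArg (fun p => p.coeff 1) h0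
          simp only [Polynomial.coeff_add, Polynomial.coeff_C_mul, Polynomial.coeff_X_one, mul_one,
            Polynomial.coeff_C_succ, add_zero, Polynomial.coeff_zero] at h1
          apply hsb0
          have := congrArg (fun y : Algebra.adjoin K₁ sT => (y : D)) h1
          simpa [ha] using this
        · have hsplit := hrel i
          rw [← Finset.add_sum_erase _ _ (Finset.mem_univ k)] at hsplit
          rw [map_add, map_mul, Polynomial.aeval_C, Polynomial.aeval_X, Polynomial.aeval_C]
          change (sb k : D) * αD (i, k) + (∑ k' ∈ Finset.univ.erase k, αD (i, k') * sb k') = 0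
          rw [mul_comm]; exact hsplit
      · exact absurd ⟨Sum.inr (i, ⟨k, hk⟩), rfl⟩ hxT
  haveI halgT : Algebra.IsAlgebraic (Algebra.adjoin K₁ sT) D :=
    ⟨fun a => IsAlgebraic.adjoin_of_forall_isAlgebraic hdiff (hbig a)⟩
  -- transcendence degrees
  have hle : Algebra.trdeg K₁ D ≤ Cardinal.mk sT := Algebra.IsAlgebraic.trdeg_le_cardinalMk K₁ sT
  have hcard : Cardinal.mk sT ≤ (n * t : ℕ) := by
    have ht : 1 ≤ t := Nat.succ_le_of_lt k₀.pos
    have hι : Fintype.card ι = n * t := by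
      simp only [ι, Fintype.card_sum, Fintype.card_prod, Fintype.card_fin, Fintype.card_subtype_compl,
        Fintype.card_unique]
      calc n + n * (t - 1) = n * 1 + n * (t - 1) := by rw [mul_one]
        _ = n * (1 + (t - 1)) := by rw [mul_add]
        _ = n * t := by rw [Nat.add_sub_cancel' ht]
    have h := Cardinal.mk_range_le_lift (f := v)
    rw [Cardinal.mk_fintype ι, hι, Cardinal.lift_natCast, Cardinal.lift_uzero] at h
    exact h
  have hK₂ : Algebra.trdeg K₁ K₂ = (n * t : ℕ) := by
    have h := hα.lift_cardinalMk_eq_trdeg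
    rw [Cardinal.mk_fintype, Fintype.card_prod, Fintype.card_fin, Fintype.card_fin,
      Cardinal.lift_natCast] at h
    exact Cardinal.lift_eq_nat_iff.1 h.symm
  haveI : FaithfulSMul K₂ D := (faithfulSMul_iff_algebraMap_injective K₂ D).2 (algebraMap K₂ D).injective
  have hadd : Algebra.trdeg K₁ K₂ + Algebra.trdeg K₂ D = Algebra.trdeg K₁ D :=
    trdeg_add_eq K₁ K₂ (A := D)
  rw [hK₂, hs_tr] at hadd
  have hineq : ((n * t : ℕ) : Cardinal) + (s : Cardinal) ≤ ((n * t : ℕ) : Cardinal) := by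
    rw [hadd]; exact hle.trans hcard
  have hs0 : s = 0 := by
    have : ((n * t + s : ℕ) : Cardinal) ≤ ((n * t : ℕ) : Cardinal) := by
      rw [Nat.cast_add]; exact hineq
    have : n * t + s ≤ n * t := by exact_mod_cast this
    omega
  rw [hs0]; rfl

/-- **Primes off `Z(S)` containing the generic combinations are maximal.** In the setting of
`ringKrullDim_quotient_eq_zero_of_generic_combinations`, `P` is a maximal ideal (an affine domain
of dimension `0` is a field). [cite: Burgisser2000TCS, Lemma 4.3 p. 80] -/
theorem isMaximal_of_generic_combinations
    (α : Fin n × Fin t → K₂) (hα : IsTranscendenceBasis K₁ α)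
    (S : Fin t → MvPolynomial (Fin n) K₁) (P : Ideal (MvPolynomial (Fin n) K₂)) [hP : P.IsPrime]
    (hF : ∀ i, (∑ k, C (α (i, k)) * map (algebraMap K₁ K₂) (S k)) ∈ P)
    {k₀ : Fin t} (hS : map (algebraMap K₁ K₂) (S k₀) ∉ P) : P.IsMaximal := by
  have h := ringKrullDim_quotient_eq_zero_of_generic_combinations α hα S P hF hS
  haveI : IsDomain (MvPolynomial (Fin n) K₂ ⧸ P) := Ideal.Quotient.isDomain P
  haveI : Ring.KrullDimLE 0 (MvPolynomial (Fin n) K₂ ⧸ P) := by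
    rw [Ring.krullDimLE_iff, h]; exact le_of_eq (by rfl)
  exact Ideal.Quotient.maximal_of_isField P Ring.KrullDimLE.isField_of_isDomain

end Generic

/-! ### Isolating a point of a zero set -/

section Isolate

variable {K : Type*} [Field K] {n : ℕ}

/-- **Isolating polynomial.** Let `z ∈ Z(J) ⊆ Kⁿ` and suppose the ideal `𝔪_z = I({z})` is the only
prime ideal `P` with `J ⊆ P ⊆ 𝔪_z`. Then there is a polynomial `g` with `g(z) ≠ 0` and
`Z(J) ∩ {g ≠ 0} ⊆ {z}`: `z` is an isolated point of `Z(J)` in the form used by the local limit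
lemma. (Prime avoidance: product of one element of each other minimal prime of `J` outside `𝔪_z`;
the minimal primes are finitely many.) [cite: AtiyahMacdonald1969, Prop. 1.11] -/
private theorem exists_isolating_polynomial_aux (J : Ideal (MvPolynomial (Fin n) K)) (z : Fin n → K)
    (hmin : ∀ P : Ideal (MvPolynomial (Fin n) K), P.IsPrime → J ≤ P →
      P ≤ vanishingIdeal K ({z} : Set (Fin n → K)) → P = vanishingIdeal K ({z} : Set (Fin n → K))) :
    ∃ g : MvPolynomial (Fin n) K, eval z g ≠ 0 ∧
      zeroLocus K J ∩ {x | eval x g ≠ 0} ⊆ {z} := by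
  classical
  set 𝔪 : Ideal (MvPolynomial (Fin n) K) := vanishingIdeal K ({z} : Set (Fin n → K)) with h𝔪
  haveI h𝔪max : 𝔪.IsMaximal := by rw [h𝔪]; infer_instance
  have hfin := Ideal.finite_minimalPrimes_of_isNoetherianRing (MvPolynomial (Fin n) K) J
  -- one element of each other minimal prime outside `𝔪`
  have hpick : ∀ Q ∈ J.minimalPrimes, Q ≠ 𝔪 → ∃ g ∈ Q, g ∉ 𝔪 := by
    intro Q hQ hne
    by_contra h
    push Not at h
    exact hne (hmin Q hQ.1.1 hQ.1.2 h)
  choose! gQ hgQ hgQ𝔪 using hpick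
  set T := hfin.toFinset.filter (fun Q => Q ≠ 𝔪) with hT
  refine ⟨∏ Q ∈ T, gQ Q, ?_, ?_⟩
  · -- `g(z) ≠ 0`: no factor lies in the prime `𝔪`
    have hnot : (∏ Q ∈ T, gQ Q) ∉ 𝔪 := by
      intro hmem
      obtain ⟨Q, hQT, hQ𝔪⟩ := (Ideal.IsPrime.prod_mem_iff (hp := h𝔪max.isPrime)).1 hmem
      have hQ' := (Finset.mem_filter.1 hQT)
      exact hgQ𝔪 Q (hfin.mem_toFinset.1 hQ'.1) hQ'.2 hQ𝔪
    intro h0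
    apply hnot
    rw [h𝔪, mem_vanishingIdeal_singleton_iff, aeval_eq_eval]
    exact h0
  · rintro x ⟨hxJ, hxg⟩
    set 𝔪x : Ideal (MvPolynomial (Fin n) K) := vanishingIdeal K ({x} : Set (Fin n → K)) with h𝔪x
    haveI h𝔪xmax : 𝔪x.IsMaximal := by rw [h𝔪x]; infer_instance
    have hJx : J ≤ 𝔪x := by
      intro p hp
      rw [h𝔪x, mem_vanishingIdeal_singleton_iff]
      exact hxJ p hp
    obtain ⟨Q, hQ, hQx⟩ := Ideal.exists_minimalPrimes_le hJx
    by_cases hQ𝔪 : Q = 𝔪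
    · -- then `𝔪_z ≤ 𝔪_x`, so `x = z`
      rw [hQ𝔪] at hQx
      have heq : 𝔪 = 𝔪x := h𝔪max.eq_of_le h𝔪xmax.ne_top hQx
      rw [h𝔪, h𝔪x] at heq
      exact Set.mem_singleton_iff.2 (eq_of_vanishingIdeal_singleton_eq heq).symm
    · exfalso
      apply hxg
      have hmemT : Q ∈ T := Finset.mem_filter.2 ⟨hfin.mem_toFinset.2 hQ, hQ𝔪⟩
      have hgx : gQ Q ∈ 𝔪x := hQx (hgQ Q hQ hQ𝔪)
      rw [h𝔪x, mem_vanishingIdeal_singleton_iff, aeval_eq_eval] at hgx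
      show eval x (∏ Q ∈ T, gQ Q) = 0
      rw [map_prod]
      exact Finset.prod_eq_zero hmemT hgx

/-- **Isolating polynomial, finiteness form**: under the same hypothesis, `z` is an isolated zero of
`J` in the sense of `eval_sLead_pertCharpoly_eq_zero_of_isolated` — there is `g` with `g(z) ≠ 0`
and `Z(J) ∩ {g ≠ 0}` finite (indeed `⊆ {z}`); prime avoidance over the finitely many minimal
primes of `J`. [cite: AtiyahMacdonald1969, Prop. 1.11] -/
theorem exists_isolating_polynomial (J : Ideal (MvPolynomial (Fin n) K)) (z : Fin n → K)
    (hmin : ∀ P : Ideal (MvPolynomial (Fin n) K), P.IsPrime → J ≤ P →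
      P ≤ vanishingIdeal K ({z} : Set (Fin n → K)) → P = vanishingIdeal K ({z} : Set (Fin n → K))) :
    ∃ g : MvPolynomial (Fin n) K, eval z g ≠ 0 ∧ zeroLocus K J ∩ {x | eval x g ≠ 0} ⊆ {z} ∧
      (zeroLocus K J ∩ {x | eval x g ≠ 0}).Finite := by
  obtain ⟨g, hg, hsub⟩ := exists_isolating_polynomial_aux J z hmin
  exact ⟨g, hg, hsub, (Set.finite_singleton z).subset hsub⟩

end Isolate

end Literature.RingTheory.Elimination
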